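import Literature.NumberTheory.EllipticCurves.GreenbergVatsal2000.CharacterPAdicLFunctions
import Literature.NumberTheory.EllipticCurves.KubotaLeopoldtIwasawaFunctionProofs
import Literature.NumberTheory.EllipticCurves.Kato2004.TeichmullerBranchIndex
import Literature.NumberTheory.EllipticCurves.FormalGroupFiniteHeightProofs
import HarnessLib

/-!
# Greenberg–Vatsal 2000, §3 pp. 41–42: the non-primitive `p`-adic `L`-function `L_{Σ₀}(C, T) ∈ Λ`
# EXISTS (Kubota–Leopoldt–Iwasawa) — proof of the `C`-half of `exists_characterLFunction`

Greenberg–Vatsal (Invent. Math. 142, p. 41): "The `p`-adic `L`-function `L(C, χ, T) ∈ Λ` is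
characterized by the interpolation property (26) … `L(C, χ, T)` is related to the Kubota–Leopoldt
`p`-adic `L`-function `L_p(χωψ⁻¹, s)` by `L_p(χωψ⁻¹, s) = L(C, χ, κ(γ)^{−s} − 1)`"; p. 42: "To
obtain the nonprimitive `p`-adic `L`-function `L_{Σ₀}(C, χ, T)`, one multiplies `L(C, χ, T)` by the
`l`-th Euler factors".  The existence of such an element of `Λ` is Iwasawa's theorem (Lang,
*Cyclotomic Fields I and II*, Ch. 4 §3, Thm. 3.2: `L_p(1−k, χ) = −(1/k)B_{k,χω^{-k}}`, with the
power series of §1 Ex. 2).  Here it is DERIVED in the kernel from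
`KubotaLeopoldtIwasawaFunctionProofs.exists_iwasawaFunction_of_bernoulliMeasure` applied to the
`Σ₀ ∪ {p}`-depleted character `θ = φω⁻¹` (`depletedEvenCharacterTwist p φ S₀ 1`) and its twists
`θ_j = φω^{-(j+1)}` (`depletedEvenCharacterTwist p φ S₀ (j+1)`):

* Teichmüller-lift algebra (`teichmullerLift_mul`, `toZMod_teichmullerLift`,
  `teichmullerLift_toZMod_rootsOfUnity`, …);
* the properties of `depletedEvenCharacterTwist` (periodicity modulo `depletedModulus`,
  vanishing on `pℤ`, complete multiplicativity, the twist relation);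
* `exists_regulariser_C` — Lang's "select `c` such that `χ(c) ≠ 1`" for a primitive `φ` of
  conductor `m > 1`, prime to `Σ₀ ∪ {p}` (Chinese remainder theorem);
* `exists_isCharacterLFunctionC` — **there is `g ∈ Λ` with `IsCharacterLFunctionC p φ S₀ g`.**

Everything is proved; there are no named facts.

## References

* R. Greenberg, V. Vatsal, *On the Iwasawa invariants of elliptic curves*, Invent. Math. 142
  (2000), §3 pp. 41–42. [GreenbergVatsal2000]
* S. Lang, *Cyclotomic Fields I and II*, GTM 121, Springer 1990, Ch. 4 §3 Thm. 3.2 (PDF p. 84).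
  [LangCyclotomic1990]
-/

noncomputable section

open scoped Classical

open NumberField IsDedekindDomain Finset PowerSeries

namespace Literature.NumberTheory.EllipticCurves.GreenbergVatsal2000

open CyclotomicZp

variable (p : ℕ) [Fact p.Prime]

/-! ### Teichmüller lifts -/

/-- `ω` extended by zero is multiplicative (Lang Ch. 1 §2: the Teichmüller CHARACTER).
[cite: LangCyclotomic1990, Ch. 1 §2 (the Teichmüller character)] -/
theorem teichmullerLift_mul (x y : ZMod p) :
    teichmullerLift p (x * y) = teichmullerLift p x * teichmullerLift p y := by
  by_cases hx : x = 0
  · rw [hx, zero_mul, teichmullerLift_zero, zero_mul]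
  by_cases hy : y = 0
  · rw [hy, mul_zero, teichmullerLift_zero, mul_zero]
  rw [teichmullerLift_of_ne_zero (mul_ne_zero hx hy), teichmullerLift_of_ne_zero hx,
    teichmullerLift_of_ne_zero hy, ← Units.val_mul, ← map_mul]
  congr 2
  ext; rfl

/-- `ω(1) = 1` (Lang Ch. 1 §2: the Teichmüller character). [cite: LangCyclotomic1990, Ch. 1 §2 (the Teichmüller character)] -/
theorem teichmullerLift_one : teichmullerLift p 1 = 1 := by
  rw [teichmullerLift_of_ne_zero one_ne_zero]
  have : Units.mk0 (1 : ZMod p) one_ne_zero = 1 := by ext; rfl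
  rw [this, map_one, Units.val_one]

/-- `ω` extended by zero commutes with powers (Lang Ch. 1 §2: the Teichmüller character).
[cite: LangCyclotomic1990, Ch. 1 §2 (the Teichmüller character)] -/
theorem teichmullerLift_pow (x : ZMod p) (n : ℕ) :
    teichmullerLift p (x ^ n) = teichmullerLift p x ^ n := by
  induction n with
  | zero => rw [pow_zero, pow_zero, teichmullerLift_one]
  | succ n ih => rw [pow_succ, pow_succ, teichmullerLift_mul, ih]

/-- `ω(x) ≡ x (mod p)`: the reduction of the Teichmüller lift of `x` is `x`
(Lang Ch. 1 §2: "`ω(u) mod 𝔭 = u`"). [cite: LangCyclotomic1990, Ch. 1 §2 (the Teichmüller character)] -/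
theorem toZMod_teichmullerLift (x : ZMod p) : PadicInt.toZMod (teichmullerLift p x) = x := by
  by_cases hx : x = 0
  · rw [hx, teichmullerLift_zero, map_zero]
  · rw [teichmullerLift_of_ne_zero hx, Kato2004.toZMod_teichmullerChar]
    rfl

/-- `ω(η mod p) = η` for a Teichmüller representative `η ∈ μ_{p−1}(ℤ_p)` (odd `p`)
(Lang Ch. 1 §2: uniqueness of the Teichmüller character).
[cite: LangCyclotomic1990, Ch. 1 §2 (the Teichmüller character)] -/
theorem teichmullerLift_toZMod_rootsOfUnity (hp : p ≠ 2)
    (η : rootsOfUnity (torsionOrder p) ℤ_[p]) :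
    teichmullerLift p (PadicInt.toZMod ((η : ℤ_[p]ˣ) : ℤ_[p])) = ((η : ℤ_[p]ˣ) : ℤ_[p]) := by
  have hne : PadicInt.toZMod ((η : ℤ_[p]ˣ) : ℤ_[p]) ≠ 0 := by
    have hu : IsUnit (PadicInt.toZMod ((η : ℤ_[p]ˣ) : ℤ_[p])) := (η : ℤ_[p]ˣ).isUnit.map _
    exact hu.ne_zero
  rw [teichmullerLift_of_ne_zero hne]
  have hmk : Units.mk0 (PadicInt.toZMod ((η : ℤ_[p]ˣ) : ℤ_[p])) hne =
      Units.map (PadicInt.toZMod : ℤ_[p] →+* ZMod p).toMonoidHom (η : ℤ_[p]ˣ) := by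
    ext; rfl
  rw [hmk, Kato2004.teichmullerChar_toZMod_rootsOfUnity_torsionOrder p hp η]

/-- For `b ≡ η (mod p)` with `η` a Teichmüller representative: `ω(b̄⁻¹) · η = 1` (Lang Ch. 1 §2:
`ω(u) ≡ u`, uniqueness). [cite: LangCyclotomic1990, Ch. 1 §2 (the Teichmüller character)] -/
theorem teichmullerLift_inv_mul_eq_one (hp : p ≠ 2) (η : rootsOfUnity (torsionOrder p) ℤ_[p])
    {x : ZMod p} (hx : x = PadicInt.toZMod ((η : ℤ_[p]ˣ) : ℤ_[p])) :
    teichmullerLift p x⁻¹ * ((η : ℤ_[p]ˣ) : ℤ_[p]) = 1 := by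
  have hne : x ≠ 0 := by
    rw [hx]; exact ((η : ℤ_[p]ˣ).isUnit.map _).ne_zero
  conv_lhs => rw [← teichmullerLift_toZMod_rootsOfUnity p hp η, ← hx, ← teichmullerLift_mul,
    inv_mul_cancel₀ hne, teichmullerLift_one]

/-! ### The depleted character `θ_k = φω^{-k} · 1_{(·, pΣ₀) = 1}` -/

section Character

variable {m : ℕ} (φ : DirichletCharacter (ZMod p) m) (S₀ : Finset (HeightOneSpectrum (𝓞 ℚ)))

/-- `θ_k` vanishes on the multiples of `p` (the factor `1_{p ∤ a}`; Lang Ch. 2 §2 "we define its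
value to be `0` on elements … not prime to `p`"). [cite: LangCyclotomic1990, Ch. 2 §2, before Thm. 2.4 (PDF p. 38)] -/
theorem depletedEvenCharacterTwist_eq_zero_of_dvd (k : ℕ) {a : ℕ} (ha : p ∣ a) :
    depletedEvenCharacterTwist p φ S₀ k a = 0 := by
  unfold depletedEvenCharacterTwist evenCharacterTwist
  split_ifs <;> rfl

/-- `θ_k` is periodic modulo `N = m · p · ∏_{v∈Σ₀} ℓ_v` (a Dirichlet character "extended by the value
`0` on integers not prime to `N`", Lang Ch. 2 §2 **B 6**–**B 7**).
[cite: LangCyclotomic1990, Ch. 2 §2, B 6–B 7 (PDF p. 35)] -/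
theorem depletedEvenCharacterTwist_add_depletedModulus (k a : ℕ) :
    depletedEvenCharacterTwist p φ S₀ k (a + depletedModulus p S₀ m) =
      depletedEvenCharacterTwist p φ S₀ k a := by
  have hN : ∀ v ∈ S₀, Rat.HeightOneSpectrum.natGenerator v ∣ depletedModulus p S₀ m := fun v hv ↦
    Dvd.dvd.mul_left (Finset.dvd_prod_of_mem _ hv) _
  have hpN : p ∣ depletedModulus p S₀ m := by
    unfold depletedModulus; exact Dvd.dvd.mul_right (dvd_mul_left p m) _
  have hmN : m ∣ depletedModulus p S₀ m := by
    unfold depletedModulus; exact Dvd.dvd.mul_right (dvd_mul_right m p) _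
  have h1 : (∃ v ∈ S₀, Rat.HeightOneSpectrum.natGenerator v ∣ a + depletedModulus p S₀ m) ↔
      ∃ v ∈ S₀, Rat.HeightOneSpectrum.natGenerator v ∣ a := by
    exact exists_congr fun v ↦ and_congr_right fun hv ↦ Nat.dvd_add_left (hN v hv)
  have h2 : (p ∣ a + depletedModulus p S₀ m) ↔ p ∣ a := Nat.dvd_add_left hpN
  have h3 : ((a + depletedModulus p S₀ m : ℕ) : ZMod m) = a := by
    rw [Nat.cast_add, (ZMod.natCast_eq_zero_iff _ _).mpr hmN, add_zero]
  have h4 : ((a + depletedModulus p S₀ m : ℕ) : ZMod p) = a := by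
    rw [Nat.cast_add, (ZMod.natCast_eq_zero_iff _ _).mpr hpN, add_zero]
  unfold depletedEvenCharacterTwist evenCharacterTwist
  simp only [h1, h2, h3, h4]

/-- `θ_k` is completely multiplicative. [cite: LangCyclotomic1990, Ch. 2 §2, B 6–B 7 (PDF p. 35)] -/
theorem depletedEvenCharacterTwist_mul (k x y : ℕ) :
    depletedEvenCharacterTwist p φ S₀ k (x * y) =
      depletedEvenCharacterTwist p φ S₀ k x * depletedEvenCharacterTwist p φ S₀ k y := by
  have hprime : ∀ v ∈ S₀, (Rat.HeightOneSpectrum.natGenerator v).Prime := fun v _ ↦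
    Rat.HeightOneSpectrum.prime_natGenerator v
  unfold depletedEvenCharacterTwist evenCharacterTwist
  by_cases hx : ∃ v ∈ S₀, Rat.HeightOneSpectrum.natGenerator v ∣ x
  · have hxy : ∃ v ∈ S₀, Rat.HeightOneSpectrum.natGenerator v ∣ x * y := by
      obtain ⟨v, hv, h⟩ := hx; exact ⟨v, hv, Dvd.dvd.mul_right h y⟩
    simp only [hx, hxy, if_true, zero_mul]
  by_cases hy : ∃ v ∈ S₀, Rat.HeightOneSpectrum.natGenerator v ∣ y
  · have hxy : ∃ v ∈ S₀, Rat.HeightOneSpectrum.natGenerator v ∣ x * y := by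
      obtain ⟨v, hv, h⟩ := hy; exact ⟨v, hv, Dvd.dvd.mul_left h x⟩
    simp only [hy, hxy, if_true, mul_zero]
  have hxy : ¬ ∃ v ∈ S₀, Rat.HeightOneSpectrum.natGenerator v ∣ x * y := by
    rintro ⟨v, hv, h⟩
    rcases (Nat.Prime.dvd_mul (hprime v hv)).mp h with h | h
    · exact hx ⟨v, hv, h⟩
    · exact hy ⟨v, hv, h⟩
  simp only [hx, hy, hxy, if_false]
  by_cases hpx : p ∣ x
  · simp only [hpx, Dvd.dvd.mul_right hpx y, if_true, zero_mul]
  by_cases hpy : p ∣ y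
  · simp only [hpy, Dvd.dvd.mul_left hpy x, if_true, mul_zero]
  have hpxy : ¬ p ∣ x * y := fun h ↦ by
    rcases (Nat.Prime.dvd_mul Fact.out).mp h with h | h
    · exact hpx h
    · exact hpy h
  simp only [hpx, hpy, hpxy, if_false, ← teichmullerLift_mul]
  congr 1
  push_cast
  rw [map_mul, mul_inv, mul_pow]
  ring

/-- **The twist relation** `θ_{j+1}(b) · η^j = θ_1(b)` for `b ≡ η (mod p)`, `η ∈ μ_{p−1}(ℤ_p)`:
`θ_{j+1} = θ_1 · ω^{-j}` and `ω(b) = η` (Lang Ch. 4 §3: `⟨a⟩^{k-1}χ(a)ω(a)⁻¹ = a^{k-1}ω(a)^{-k}χ(a)`).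
[cite: LangCyclotomic1990, Ch. 4 §3, proof of Thm. 3.2 (PDF p. 84)] -/
theorem depletedEvenCharacterTwist_twist (hp : p ≠ 2) (j b : ℕ)
    (η : rootsOfUnity (torsionOrder p) ℤ_[p])
    (hb : (b : ZMod p) = PadicInt.toZMod ((η : ℤ_[p]ˣ) : ℤ_[p])) :
    depletedEvenCharacterTwist p φ S₀ (j + 1) b * ((η : ℤ_[p]ˣ) : ℤ_[p]) ^ j =
      depletedEvenCharacterTwist p φ S₀ 1 b := by
  unfold depletedEvenCharacterTwist evenCharacterTwist
  split_ifs with h1 h2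
  · rw [zero_mul]
  · rw [zero_mul]
  · rw [pow_one, teichmullerLift_mul, teichmullerLift_mul, teichmullerLift_pow]
    have h := teichmullerLift_inv_mul_eq_one p hp η hb
    calc teichmullerLift p (φ (b : ZMod m)) * teichmullerLift p ((b : ZMod p)⁻¹) ^ (j + 1) *
          ((η : ℤ_[p]ˣ) : ℤ_[p]) ^ j
        = teichmullerLift p (φ (b : ZMod m)) * teichmullerLift p ((b : ZMod p)⁻¹) *
            (teichmullerLift p ((b : ZMod p)⁻¹) * ((η : ℤ_[p]ˣ) : ℤ_[p])) ^ j := by ring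
      _ = teichmullerLift p (φ (b : ZMod m)) * teichmullerLift p ((b : ZMod p)⁻¹) := by
          rw [h, one_pow, mul_one]

/-- `θ_{j+1}` on an integer prime to `pΣ₀`: `θ_{j+1}(c) = ω(φ(c)) ω(c̄⁻¹)^{j+1}`. [folklore] -/
private theorem depletedEvenCharacterTwist_of_not_dvd (k : ℕ) {c : ℕ} (hpc : ¬ p ∣ c)
    (hSc : ¬ ∃ v ∈ S₀, Rat.HeightOneSpectrum.natGenerator v ∣ c) :
    depletedEvenCharacterTwist p φ S₀ k c =
      teichmullerLift p (φ (c : ZMod m) * ((c : ZMod p)⁻¹) ^ k) := by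
  unfold depletedEvenCharacterTwist evenCharacterTwist
  rw [if_neg hSc, if_neg hpc]

end Character

/-! ### Choice of the regulariser `c` ("select `c` such that `χ(c) ≠ 1`") -/

section Regulariser

variable {m : ℕ} [NeZero m] (φ : DirichletCharacter (ZMod p) m)
  (S₀ : Finset (HeightOneSpectrum (𝓞 ℚ)))

/-- A primitive character of conductor `m` with `p ∣ m` is non-trivial: some unit `u` has
`φ(u) ≠ 1` (the trivial character has conductor `1`). [folklore] -/
private theorem exists_unit_apply_ne_one (hpm : p ∣ m) (hφ : φ.IsPrimitive) :
    ∃ u : (ZMod m)ˣ, φ u ≠ 1 := by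
  by_contra h
  push Not at h
  have h1 : φ = 1 := MulChar.ext fun u ↦ by rw [h u, MulChar.one_apply_coe]
  have hcond : m = 1 := by
    have := hφ
    rw [DirichletCharacter.isPrimitive_def, h1, DirichletCharacter.conductor_one] at this
    exact this.symm
  have hp1 : p ∣ 1 := hcond ▸ hpm
  exact (Fact.out : p.Prime).one_lt.ne' (Nat.dvd_one.mp hp1)

/-- **Choice of `c`** (Lang Ch. 4 §3: "If `χ` is non-trivial, we can select `c` such that
`χ(c) ≠ 1`"): for `φ` primitive of conductor `m` with `p ∣ m` there is an integer `c` prime to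
`N = m p ∏_{v∈Σ₀} ℓ_v` and to `p`, divisible by no `ℓ_v`, with `φ(c) ≠ 1` — by the Chinese
remainder theorem (`c ≡ u mod m`, `c ≡ 1` modulo the `ℓ_v ∤ m`).
[cite: LangCyclotomic1990, Ch. 4 §3, definition of L_p (PDF p. 84)] -/
theorem exists_regulariser_C (hpm : p ∣ m) (hφ : φ.IsPrimitive) :
    ∃ c : ℕ, c.Coprime (depletedModulus p S₀ m * p) ∧ ¬ p ∣ c ∧
      (¬ ∃ v ∈ S₀, Rat.HeightOneSpectrum.natGenerator v ∣ c) ∧ φ (c : ZMod m) ≠ 1 := by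
  have pp : p.Prime := Fact.out
  obtain ⟨u, hu⟩ := exists_unit_apply_ne_one p φ hpm hφ
  set M₂ : ℕ := ∏ v ∈ S₀.filter (fun v ↦ ¬ Rat.HeightOneSpectrum.natGenerator v ∣ m),
    Rat.HeightOneSpectrum.natGenerator v with hM₂
  have hcop : m.Coprime M₂ := by
    refine Nat.Coprime.prod_right fun v hv ↦ ?_
    have hv' := (Finset.mem_filter.mp hv).2
    exact ((Nat.Prime.coprime_iff_not_dvd (Rat.HeightOneSpectrum.prime_natGenerator v)).mpr hv').symm
  obtain ⟨c, hc1, hc2⟩ := Nat.chineseRemainder hcop (u : ZMod m).val 1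
  have hcu : (c : ZMod m) = (u : ZMod m) := by
    rw [← ZMod.natCast_zmod_val (u : ZMod m)]
    exact (ZMod.natCast_eq_natCast_iff' _ _ _).mpr hc1
  have hcm : c.Coprime m := (ZMod.isUnit_iff_coprime c m).mp (hcu ▸ u.isUnit)
  have hcp : c.Coprime p := Nat.Coprime.coprime_dvd_right hpm hcm
  have hpc : ¬ p ∣ c := fun h ↦ by
    have := Nat.dvd_gcd h (dvd_refl p)
    rw [hcp] at this
    exact pp.one_lt.ne' (Nat.dvd_one.mp this)
  have hcv : ∀ v ∈ S₀, c.Coprime (Rat.HeightOneSpectrum.natGenerator v) := by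
    intro v hv
    by_cases hvm : Rat.HeightOneSpectrum.natGenerator v ∣ m
    · exact Nat.Coprime.coprime_dvd_right hvm hcm
    · have hvM : Rat.HeightOneSpectrum.natGenerator v ∣ M₂ :=
        Finset.dvd_prod_of_mem _ (Finset.mem_filter.mpr ⟨hv, hvm⟩)
      have h1 : c ≡ 1 [MOD Rat.HeightOneSpectrum.natGenerator v] := Nat.ModEq.of_dvd hvM hc2
      have h2 := h1.gcd_eq
      rwa [Nat.gcd_one_left] at h2
  have hSc : ¬ ∃ v ∈ S₀, Rat.HeightOneSpectrum.natGenerator v ∣ c := by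
    rintro ⟨v, hv, hdvd⟩
    have h := Nat.dvd_gcd hdvd (dvd_refl (Rat.HeightOneSpectrum.natGenerator v))
    rw [hcv v hv] at h
    exact (Rat.HeightOneSpectrum.prime_natGenerator v).one_lt.ne' (Nat.dvd_one.mp h)
  refine ⟨c, ?_, hpc, hSc, by rwa [hcu]⟩
  unfold depletedModulus
  exact ((hcm.mul_right hcp).mul_right (Nat.Coprime.prod_right hcv)).mul_right hcp

end Regulariser

/-! ### Existence of `L_{Σ₀}(C, T)` -/

/-- `N = m p ∏ ℓ_v ≠ 0`. [folklore] -/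
private theorem depletedModulus_ne_zero {m : ℕ} [NeZero m] (S₀ : Finset (HeightOneSpectrum (𝓞 ℚ))) :
    depletedModulus p S₀ m ≠ 0 := by
  unfold depletedModulus
  exact mul_ne_zero (mul_ne_zero (NeZero.ne m) (Fact.out : p.Prime).ne_zero)
    (Finset.prod_ne_zero_iff.mpr fun v _ ↦ (Rat.HeightOneSpectrum.prime_natGenerator v).ne_zero)

/-- **Greenberg–Vatsal p. 41 / Kubota–Leopoldt–Iwasawa: `L_{Σ₀}(C, T) ∈ Λ` exists** — for an odd
prime `p`, a primitive Dirichlet character `φ` modulo `m` with `p ∣ m` (values in `𝔽_p`,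
Teichmüller-lifted) and a finite set `Σ₀` of places, there is `g ∈ Λ = ℤ_p⟦T⟧` with the
interpolation property `IsCharacterLFunctionC p φ Σ₀ g`
(`g(κ(γ)^{k−1} − 1) = −(1/k)B_{k,φω^{-k}·1_{Σ₀}}`, `k ≥ 1`): Lang Ch. 4 §3 Thm. 3.2
(`L_p(1−k,χ) = −(1/k)B_{k,χω^{-k}}`) for the measure `θE_{1,c}`, `θ = φω⁻¹·1_{(·,pΣ₀)=1}`, divided by
the unit `1 − θ(c)c(1+T)^{e}` of `Λ`. [cite: GreenbergVatsal2000, §3 p. 41 (L(C,χ,T) ∈ Λ and its relation with L_p(χωψ⁻¹,s))]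
[cite: LangCyclotomic1990, Ch. 4 §3, Thm. 3.2 (PDF p. 84)] -/
theorem exists_isCharacterLFunctionC {m : ℕ} [NeZero m] (φ : DirichletCharacter (ZMod p) m)
    (S₀ : Finset (HeightOneSpectrum (𝓞 ℚ))) (hp : p ≠ 2) (hpm : p ∣ m) (hφ : φ.IsPrimitive) :
    ∃ g : IwasawaAlgebra p, IsCharacterLFunctionC p φ S₀ g := by
  have pp : p.Prime := Fact.out
  obtain ⟨c, hcN, hpc, hSc, hφc⟩ := exists_regulariser_C p φ S₀ hpm hφ
  haveI : NeZero (depletedModulus p S₀ m) := ⟨depletedModulus_ne_zero p S₀⟩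
  have hc0 : (c : ZMod p) ≠ 0 := fun h ↦ hpc ((ZMod.natCast_eq_zero_iff c p).mp h)
  -- `θ = φω⁻¹` (depleted) and its twists `θ_j = φω^{-(j+1)}`
  have hunit : IsUnit (1 - depletedEvenCharacterTwist p φ S₀ 1 c * c : ℤ_[p]) := by
    apply isUnit_of_toZMod_ne_zero
    rw [map_sub, map_one, map_mul, map_natCast, depletedEvenCharacterTwist_of_not_dvd p φ S₀ 1 hpc hSc,
      toZMod_teichmullerLift, pow_one, mul_assoc, inv_mul_cancel₀ hc0, mul_one, sub_ne_zero]
    exact Ne.symm hφc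
  obtain ⟨g, _g', hg⟩ := exists_iwasawaFunction_of_bernoulliMeasure p hp hcN
    (θ := depletedEvenCharacterTwist p φ S₀ 1)
    (depletedEvenCharacterTwist_add_depletedModulus p φ S₀ 1)
    (fun b hb ↦ depletedEvenCharacterTwist_eq_zero_of_dvd p φ S₀ 1 hb) hunit
    (fun j ↦ depletedEvenCharacterTwist p φ S₀ (j + 1))
    (fun j ↦ depletedEvenCharacterTwist_add_depletedModulus p φ S₀ (j + 1))
    (fun j b hb ↦ depletedEvenCharacterTwist_eq_zero_of_dvd p φ S₀ (j + 1) hb)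
    (fun j ↦ depletedEvenCharacterTwist_mul p φ S₀ (j + 1) c)
    (fun j b η hb ↦ depletedEvenCharacterTwist_twist p φ S₀ hp j b η hb)
  refine ⟨g, fun k hk ↦ ?_⟩
  obtain ⟨j, rfl⟩ : ∃ j, k = j + 1 := ⟨k - 1, by omega⟩
  have h := (hg j).1
  simp only [Nat.add_sub_cancel]
  convert h using 1
  unfold characterLValueC twistedBernoulli
  rw [Nat.add_sub_cancel, one_div, neg_mul]

end Literature.NumberTheory.EllipticCurves.GreenbergVatsal2000

end
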